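import Summits.QuantumFields.BalabanUV.Beta.D1BFx.GhostKernelComplete
import Summits.QuantumFields.BalabanUV.Beta.D1BFx.GluonKernelSectors

/-!
# `BalabanUV.Beta.D1BFx.GhostDeltaWords` — road «BF-x» for binder row D1, slot (K), «RK-GH-UNIT» FILE 5a («ΔGH-WORDS», OWNER RULING ρ-g16-2 (Δ3d) «ΔGH DIRECT»):
# **THE cQ-SECTOR OF THE COMPLETED GHOST KERNEL AS FOUR ONE-LEG WORDS, POINTWISE**:
# `PghQ n a x₀ cK cQ − PghQ n a x₀ cK 0 = ½·tadpole Ggh (W_Q) − ½·(bubble Ggh V_Q V_K + bubble Ggh V_K V_Q + bubble Ggh V_Q V_Q)` with the PURE-`Q` packed jets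
# `V_Q := vertexRedF n (SghAt ρ n 0 cQ)`, `W_Q := tableRedF n (WghAt ρ n x₀ 0 cQ)` and the kinetic jet `V_K := vertexRedF n (SghAt ρ n cK 0)` (`ρ = ctrHalf n`)

HONEST DEPENDENCY (cell records, verbatim): «continuum YM on T⁴ ⇐ BetaPertH ∧ nine spine estimates (0/9 proved); BetaPertH ⇐ (D1) ∧ (D4) ∧
CAP+tail; G-an2-4 gates asym, D1 and NE2/3/4.»  HONEST FRAMING (cell contract, verbatim): «discharging `BetaPertH` makes Bałaban's UV stability
UNCONDITIONAL — a real constructive-QFT result; it is NOT the continuum limit and NOT the Clay problem.»  THIS MODULE DISCHARGES NOTHING of the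
wall: [folklore] bilinearity bookkeeping over the road's OWN ghost model (leaf-02∕leaf-04 `GhostKernelComplete.PghQ`, `GhostStencilRooted.SghAt`,
`GhostAveragingSquare.WghAt`) with an2's `TameKernelCalculus.tadpole_add`∕`bubble_add_left`∕`bubble_add_right`, `ChartConjugationReflection.wsum_add` and the
typer's `ReducedKernelF.vertexRedF`∕`ReducedTableF.tableRedF`.  No `def`, no `def … : Prop`, nothing cited, 0 sorry.  NO row is proved here (the masses and the
(1.22) row of ΔGH are FILE 5b∕5c); 0 root-level binders of row D1 discharged (hW ∕ hR-sockets ∕ hSX-socket ∕ D1Tel ∕ D1Rep — 0); (K) NOT closed; NOT D1, NOT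
`BetaPertH`, NOT continuum, NOT Clay.

ABSOLUTE RULE (cell charter, verbatim): «No internally-minted statement may enter as a cited fact. Every hypothesis is either kernel-proved in
this package or a verbatim quotation of a PUBLISHED theorem with page reference. The manuscript(s) under audit are NOT citable for their own
disputed steps — they are the thing under adjudication; programme-internal (2001/route/tribunal) claims are never citable.»

WHY (OWNER d1-p2 g16 RULING ρ-g16-2 «ΔGH ROWS», journal l.38331: ΔGH := `2·(PghQ(−1,n²,0) − PghQ(−1,n²,a))` is, POINTWISE, `−2 ×` the four cQ-sector
one-leg words KQ + QK + QQ + qSq of `hessKer (Ggh n a)` — «`hessKer` is quadratic in the first jet, linear in the table» — and its unit row is to be proved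
DIRECTLY from these words by FILE 1b's lemmas; RK-GH-UNIT FILE 5 = my first refusal, accepted [D1LEAF04-G18-STAGED-3]).  This file is the identity
half: the stencil∕table of the completed triple SPLIT at the weights (`SghAt ρ n cK cQ = SghAt ρ n cK 0 + SghAt ρ n 0 cQ`, `WghAt ρ n x₀ cK cQ = WghAt ρ n x₀ cK 0
+ WghAt ρ n x₀ 0 cQ`), the packings are additive (`vertexRedF_add`, `tableRedF_add` — `wsum_add` under absolutely summable `ℋ`-weights and bounded
stencils), and `hessKer` is bilinear on localised pieces.

CONTENT (all [folklore]; fibre `F` generic in §1, the road's ghost model in §2–§3; `n ≥ 1`, `ρ = ctrHalf n`):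
* §1 `abs_wsum_le_of_bdd` (with `GluonKernelSectors.summable_abs_wH`), **`vertexRedF_add`**, **`tableRedF_add`** (uniformly bounded families).
* §2 `abs_le_of_biLoc_family`, **`SghAt_split`**, `diagExt_zero_smul`, **`WghAt_split`**, the uniform bounds `abs_SghAt_le`, `abs_WghAt_le`.
* §3 `loc_vertexRedF_SghAt`, `loc_tableRedF_WghAt`, **`PghQ_sub_PghQ_cQ_zero`** (the identity above, every `x₀ cK cQ μ ν z`, `0 < a`), and at the pins of record
  **`deltaGH_eq_words`**: `2·(PghQ n a (−1) n² 0 − PghQ n a (−1) n² a) μ ν z = −tadpole Ggh (W_Q μ 0 ν z) + (bubble Ggh (V_Q μ 0) (V_K ν z) + bubble Ggh (V_K μ 0) (V_Q ν z) + bubble Ggh (V_Q μ 0) (V_Q ν z))`.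
NOT HERE (honest): the masses of `V_Q`, `W_Q` (FILE 5b), the (1.22) row of ΔGH (FILE 5c), the `Rk` wiring (leaf-01).
Unit `b2b-balaban-beta-d1-formalise-leaf-04` (gen 18), D1 formalisation swarm leaf prover 04, road «BF-x»; «RK-GH-UNIT» FILE 5a (journal).
-/

noncomputable section

open Finset
open scoped BigOperators
open Literature.MathematicalPhysics.QuantumFieldTheory.Balaban1983to89
open Literature.MathematicalPhysics.QuantumFieldTheory.Balaban1983to89.Beta
open B12Sec2to5 (l1 l1_nonneg)
open ExpKernelCalculus (Site MKer BiLoc VertexFamily VertexFamily₂ hessKer bubble tadpole summable_exp_shift')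
open KernelSpecInstance (wH decay_wH)
open OneStepResolventKernel (wsum)
open Summit.QuantumFields.BalabanUV.Beta.TameKernelCalculus (Spr Loc tadpole_add bubble_add_left bubble_add_right)
open Summit.QuantumFields.BalabanUV.Beta.ChartConjugationReflection (wsum_add)
open Summit.QuantumFields.BalabanUV.Beta.D1BFx.GluonKernelSectors (summable_abs_wH)
open Summit.QuantumFields.BalabanUV.Beta.D1BFx.GhostLeg (Ggh spr_Ggh)
open Summit.QuantumFields.BalabanUV.Beta.D1BFx.GhostStencil (ghCur)
open Summit.QuantumFields.BalabanUV.Beta.D1BFx.GhostStencilReflection (ghX)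
open Summit.QuantumFields.BalabanUV.Beta.D1BFx.GhostStencilRooted (SghAt SghAt_apply qAntiAt)
open Summit.QuantumFields.BalabanUV.Beta.D1BFx.GhostStencilRootedReflection (ctrHalf ctrHalf_mem)
open Summit.QuantumFields.BalabanUV.Beta.D1BFx.GhostAveragingSquare (WghAt WghAt_eq qSqAt)
open Summit.QuantumFields.BalabanUV.Beta.D1BFx.ReducedKernelSandwichBlock (diagExt)
open Summit.QuantumFields.BalabanUV.Beta.D1BFx.ReducedKernelF (vertexRedF vertexRedF_apply)
open Summit.QuantumFields.BalabanUV.Beta.D1BFx.ReducedTableF (tableRedF tableRedF_apply)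
open Summit.QuantumFields.BalabanUV.Beta.D1BFx.GhostKernelRooted (biLoc_SghAt_ctr exists_vertexFamily_SghAt_ctr)
open Summit.QuantumFields.BalabanUV.Beta.D1BFx.GhostKernelComplete (PghQ PghQ_eq_hessKer biLoc_WghAt_ctr exists_vertexFamily₂_WghAt)

namespace Summit.QuantumFields.BalabanUV.Beta.D1BFx.GhostDeltaWords

/-! ## §1 Additivity of the packings on uniformly bounded families -/

section Additivity

variable {F : Type*} (n : ℕ) [NeZero n]

/-- [folklore] A superposition of uniformly bounded kernels with absolutely summable weights is bounded by `B·Σ'_u |w u|`. -/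
theorem abs_wsum_le_of_bdd {w : Site 4 → ℝ} {K : Site 4 → MKer 4 F} {B : ℝ} (hw : Summable fun u => |w u|)
    (hK : ∀ u x z a b, |K u x z a b| ≤ B) (x z : Site 4) (a b : F) : |wsum w K x z a b| ≤ B * ∑' u, |w u| := by
  unfold OneStepResolventKernel.wsum
  have hB : 0 ≤ B := (abs_nonneg _).trans (hK 0 x z a b)
  have hmaj := hw.mul_left B
  have h := tsum_of_norm_bounded (f := fun u => w u * K u x z a b) hmaj.hasSum (fun u => by
    rw [Real.norm_eq_abs, abs_mul, mul_comm B]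
    exact mul_le_mul_of_nonneg_left (hK u x z a b) (abs_nonneg _))
  rw [Real.norm_eq_abs, tsum_mul_left] at h
  exact h

/-- [folklore] **THE PACKED VERTEX IS ADDITIVE** on uniformly bounded stencil families. -/
theorem vertexRedF_add {S T : Fin 4 → Site 4 → MKer 4 F} {B : ℝ} (hS : ∀ κ u x z a b, |S κ u x z a b| ≤ B) (hT : ∀ κ u x z a b, |T κ u x z a b| ≤ B)
    (μ : Fin 4) (y : Site 4) : vertexRedF n (fun κ u => S κ u + T κ u) μ y = vertexRedF n S μ y + vertexRedF n T μ y := by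
  funext x z a b
  simp only [vertexRedF_apply, Pi.add_apply, ← Finset.sum_add_distrib]
  refine Finset.sum_congr rfl fun κ _ => ?_
  have h := wsum_add (w := fun u => wH (N := n) (d := 3) κ μ (u - (n : ℤ) • y)) (S := S κ) (T := T κ) (summable_abs_wH n κ μ y)
    (hS κ) (hT κ)
  exact congrFun (congrFun (congrFun (congrFun h x) z) a) b

/-- [folklore] **THE PACKED TABLE IS ADDITIVE** on uniformly bounded table families (inner superposition by `wsum_add`, bounded by `abs_wsum_le_of_bdd`; outer by `wsum_add`). -/
theorem tableRedF_add {W W' : Fin 4 → Site 4 → Fin 4 → Site 4 → MKer 4 F} {B : ℝ} (hW : ∀ κ u l u' x z a b, |W κ u l u' x z a b| ≤ B)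
    (hW' : ∀ κ u l u' x z a b, |W' κ u l u' x z a b| ≤ B) (μ : Fin 4) (y : Site 4) (ν : Fin 4) (y' : Site 4) :
    tableRedF n (fun κ u l u' => W κ u l u' + W' κ u l u') μ y ν y' = tableRedF n W μ y ν y' + tableRedF n W' μ y ν y' := by
  -- inner additivity as an identity of kernel families of the first bond
  have hin : ∀ κ' l' : Fin 4, (fun u => wsum (fun u' => wH (N := n) (d := 3) l' ν (u' - (n : ℤ) • y'))
        ((fun κ u l u' => W κ u l u' + W' κ u l u') κ' u l'))
      = fun u => wsum (fun u' => wH (N := n) (d := 3) l' ν (u' - (n : ℤ) • y')) (W κ' u l')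
          + wsum (fun u' => wH (N := n) (d := 3) l' ν (u' - (n : ℤ) • y')) (W' κ' u l') := by
    intro κ' l'
    funext u
    exact wsum_add (w := fun u' => wH (N := n) (d := 3) l' ν (u' - (n : ℤ) • y')) (S := W κ' u l') (T := W' κ' u l')
      (summable_abs_wH n l' ν y') (hW κ' u l') (hW' κ' u l')
  -- the inner superpositions are uniformly bounded
  set M : ℝ := B * ∑' u' : Site 4, |wH (N := n) (d := 3) (0 : Fin 4) ν (u' - (n : ℤ) • y')| with hM
  have hbd : ∀ (R : Fin 4 → Site 4 → Fin 4 → Site 4 → MKer 4 F), (∀ κ u l u' x z a b, |R κ u l u' x z a b| ≤ B) →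
      ∀ (κ' l' : Fin 4) (u x z : Site 4) (a b : F),
        |wsum (fun u' => wH (N := n) (d := 3) l' ν (u' - (n : ℤ) • y')) (R κ' u l') x z a b| ≤ B * ∑' u' : Site 4, |wH (N := n) (d := 3) l' ν (u' - (n : ℤ) • y')| :=
    fun R hR κ' l' u x z a b => abs_wsum_le_of_bdd (summable_abs_wH n l' ν y') (hR κ' u l') x z a b
  funext x z a b
  simp only [Pi.add_apply, tableRedF_apply]
  rw [← Finset.sum_add_distrib]
  refine Finset.sum_congr rfl fun κ' _ => ?_
  rw [← Finset.sum_add_distrib]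
  refine Finset.sum_congr rfl fun l' _ => ?_
  rw [hin κ' l']
  have h := wsum_add (w := fun u => wH (N := n) (d := 3) κ' μ (u - (n : ℤ) • y))
    (S := fun u => wsum (fun u' => wH (N := n) (d := 3) l' ν (u' - (n : ℤ) • y')) (W κ' u l'))
    (T := fun u => wsum (fun u' => wH (N := n) (d := 3) l' ν (u' - (n : ℤ) • y')) (W' κ' u l'))
    (summable_abs_wH n κ' μ y) (fun u => hbd W hW κ' l' u) (fun u => hbd W' hW' κ' l' u)
  exact congrFun (congrFun (congrFun (congrFun h x) z) a) b

end Additivity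

/-! ## §2 The completed stencil and table split at the weights; uniform bounds -/

section Split

variable (ρ : Site 4) (n : ℕ) [NeZero n]

omit [NeZero n] in
/-- [folklore] **THE STENCIL SPLITS**: `SghAt ρ n cK cQ = (κ u ↦ SghAt ρ n cK 0 κ u + SghAt ρ n 0 cQ κ u)` (`cK·ghCur + cQ·qAntiAt`, pointwise). -/
theorem SghAt_split (cK cQ : ℝ) : SghAt ρ n cK cQ = fun κ u => SghAt ρ n cK 0 κ u + SghAt ρ n 0 cQ κ u := by
  funext κ u x z a b
  simp only [Pi.add_apply, SghAt_apply]
  ring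

omit [NeZero n] in
/-- [folklore] The diagonal extension of the zero family vanishes. -/
theorem diagExt_zero_smul (x₀ : ℝ) (κ : Fin 4) (v : Site 4) (l : Fin 4) (v' : Site 4) :
    diagExt (fun μ y => (x₀ * 0) • ghX μ y) κ v l v' = 0 := by
  unfold ReducedKernelSandwichBlock.diagExt
  split_ifs <;> simp

omit [NeZero n] in
/-- [folklore] **THE TABLE SPLITS**: `WghAt ρ n x₀ cK cQ κ v l v' = WghAt ρ n x₀ cK 0 κ v l v' + WghAt ρ n x₀ 0 cQ κ v l v'`. -/
theorem WghAt_split (x₀ cK cQ : ℝ) (κ : Fin 4) (v : Site 4) (l : Fin 4) (v' : Site 4) :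
    WghAt ρ n x₀ cK cQ κ v l v' = WghAt ρ n x₀ cK 0 κ v l v' + WghAt ρ n x₀ 0 cQ κ v l v' := by
  rw [WghAt_eq, WghAt_eq, WghAt_eq, diagExt_zero_smul, mul_zero, zero_mul, neg_zero, zero_smul, add_zero, zero_add]

/-- [folklore] A family bi-localised at its own bonds with a nonnegative rate is uniformly bounded by the constant. -/
theorem abs_le_of_biLoc_family {K : MKer 4 Unit} {p q : Site 4} {C δ : ℝ} (h : BiLoc K p q C δ) (hδ : 0 ≤ δ) (x z : Site 4) (a b : Unit) :
    |K x z a b| ≤ C := by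
  have hC : 0 ≤ C := h.nonneg a
  refine (h x z a b).trans (mul_le_of_le_one_right hC ?_)
  rw [Real.exp_le_one_iff]
  nlinarith [l1_nonneg (x - p), l1_nonneg (z - q)]

/-- [folklore] Uniform bound of the centre-rooted stencil (any weights). -/
theorem abs_SghAt_ctr_le (cK cQ : ℝ) (κ : Fin 4) (u x z : Site 4) (a b : Unit) :
    |SghAt (ctrHalf n) n cK cQ κ u x z a b| ≤ |cK| * Real.exp (1 / n) + |cQ| * (8 / (n : ℝ) ^ 3 * Real.exp (8 * 1)) :=
  abs_le_of_biLoc_family (biLoc_SghAt_ctr n cK cQ κ u) (by positivity) x z a b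

/-- [folklore] Uniform bound of the centre-rooted completed table (any weights). -/
theorem abs_WghAt_ctr_le (x₀ cK cQ : ℝ) (κ : Fin 4) (v : Site 4) (l : Fin 4) (v' x z : Site 4) (a b : Unit) :
    |WghAt (ctrHalf n) n x₀ cK cQ κ v l v' x z a b|
      ≤ |x₀ * cK| * Real.exp (1 / n) + |(-(x₀ * cQ * (n : ℝ) ^ 4))| * (8 / (n : ℝ) ^ 3 * Real.exp (8 * 1)) ^ 2 :=
  abs_le_of_biLoc_family (biLoc_WghAt_ctr n x₀ cK cQ κ v l v') (by positivity) x z a b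

end Split

/-! ## §3 The identity -/

section Identity

variable (n : ℕ) [NeZero n] {a : ℝ}

/-- [folklore] The packed rooted vertex is localised (`GhostKernelRooted.exists_vertexFamily_SghAt_ctr`). -/
theorem loc_vertexRedF_SghAt (cK cQ : ℝ) (μ : Fin 4) (y : Site 4) : Loc (vertexRedF n (SghAt (ctrHalf n) n cK cQ) μ y) := by
  obtain ⟨Cv, δv, hδv, hV⟩ := exists_vertexFamily_SghAt_ctr n cK cQ
  exact ⟨_, _, Cv, δv, hδv, hV μ y⟩

/-- [folklore] The packed completed table is localised (`GhostKernelComplete.exists_vertexFamily₂_WghAt`). -/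
theorem loc_tableRedF_WghAt (x₀ cK cQ : ℝ) (μ : Fin 4) (y : Site 4) (ν : Fin 4) (y' : Site 4) :
    Loc (tableRedF n (WghAt (ctrHalf n) n x₀ cK cQ) μ y ν y') := by
  obtain ⟨C2, δ2, hδ2, hW⟩ := exists_vertexFamily₂_WghAt n x₀ cK cQ
  exact ⟨_, _, C2, δ2, hδ2, hW μ y ν y'⟩

/-- [folklore] **THE cQ-SECTOR OF THE COMPLETED GHOST KERNEL AS FOUR ONE-LEG WORDS** (every `x₀ cK cQ μ ν z`, `0 < a`):
`PghQ n a x₀ cK cQ μ ν z − PghQ n a x₀ cK 0 μ ν z = ½·tadpole Ggh (W_Q μ 0 ν z) − ½·(bubble Ggh (V_Q μ 0) (V_K ν z) + bubble Ggh (V_K μ 0) (V_Q ν z) + bubble Ggh (V_Q μ 0) (V_Q ν z))`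
with `V_K := vertexRedF n (SghAt ρ n cK 0)`, `V_Q := vertexRedF n (SghAt ρ n 0 cQ)`, `W_Q := tableRedF n (WghAt ρ n x₀ 0 cQ)`, `ρ = ctrHalf n`. -/
theorem PghQ_sub_PghQ_cQ_zero (ha : 0 < a) (x₀ cK cQ : ℝ) (μ ν : Fin 4) (z : Site 4) :
    PghQ n a x₀ cK cQ μ ν z - PghQ n a x₀ cK 0 μ ν z
      = (1 / 2) * tadpole (Ggh n a) (tableRedF n (WghAt (ctrHalf n) n x₀ 0 cQ) μ 0 ν z)
        - (1 / 2) * (bubble (Ggh n a) (vertexRedF n (SghAt (ctrHalf n) n 0 cQ) μ 0) (vertexRedF n (SghAt (ctrHalf n) n cK 0) ν z)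
          + bubble (Ggh n a) (vertexRedF n (SghAt (ctrHalf n) n cK 0) μ 0) (vertexRedF n (SghAt (ctrHalf n) n 0 cQ) ν z)
          + bubble (Ggh n a) (vertexRedF n (SghAt (ctrHalf n) n 0 cQ) μ 0) (vertexRedF n (SghAt (ctrHalf n) n 0 cQ) ν z)) := by
  have hA := spr_Ggh n a ha
  -- the splits, packed
  have hV : ∀ (μ' : Fin 4) (y : Site 4), vertexRedF n (SghAt (ctrHalf n) n cK cQ) μ' y
      = vertexRedF n (SghAt (ctrHalf n) n cK 0) μ' y + vertexRedF n (SghAt (ctrHalf n) n 0 cQ) μ' y := by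
    intro μ' y
    rw [SghAt_split (ctrHalf n) n cK cQ]
    set B : ℝ := max (|cK| * Real.exp (1 / n) + |(0 : ℝ)| * (8 / (n : ℝ) ^ 3 * Real.exp (8 * 1)))
      (|(0 : ℝ)| * Real.exp (1 / n) + |cQ| * (8 / (n : ℝ) ^ 3 * Real.exp (8 * 1))) with hB
    exact vertexRedF_add n (B := B) (fun κ u x z' a' b' => (abs_SghAt_ctr_le n cK 0 κ u x z' a' b').trans (le_max_left _ _))
      (fun κ u x z' a' b' => (abs_SghAt_ctr_le n 0 cQ κ u x z' a' b').trans (le_max_right _ _)) μ' y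
  have hW : tableRedF n (WghAt (ctrHalf n) n x₀ cK cQ) μ 0 ν z
      = tableRedF n (WghAt (ctrHalf n) n x₀ cK 0) μ 0 ν z + tableRedF n (WghAt (ctrHalf n) n x₀ 0 cQ) μ 0 ν z := by
    have e : WghAt (ctrHalf n) n x₀ cK cQ = fun κ v l v' => WghAt (ctrHalf n) n x₀ cK 0 κ v l v' + WghAt (ctrHalf n) n x₀ 0 cQ κ v l v' := by
      funext κ v l v'; exact WghAt_split (ctrHalf n) n x₀ cK cQ κ v l v'
    rw [e]
    set B : ℝ := max (|x₀ * cK| * Real.exp (1 / n) + |(-(x₀ * 0 * (n : ℝ) ^ 4))| * (8 / (n : ℝ) ^ 3 * Real.exp (8 * 1)) ^ 2)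
      (|x₀ * 0| * Real.exp (1 / n) + |(-(x₀ * cQ * (n : ℝ) ^ 4))| * (8 / (n : ℝ) ^ 3 * Real.exp (8 * 1)) ^ 2) with hB
    exact tableRedF_add n (B := B) (fun κ u l u' x z' a' b' => (abs_WghAt_ctr_le n x₀ cK 0 κ u l u' x z' a' b').trans (le_max_left _ _))
      (fun κ u l u' x z' a' b' => (abs_WghAt_ctr_le n x₀ 0 cQ κ u l u' x z' a' b').trans (le_max_right _ _)) μ 0 ν z
  -- bilinearity on localised pieces
  have hLK := loc_vertexRedF_SghAt n cK 0
  have hLQ := loc_vertexRedF_SghAt n 0 cQ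
  rw [PghQ_eq_hessKer, PghQ_eq_hessKer]
  simp only [ExpKernelCalculus.hessKer]
  rw [hW, hV μ 0, hV ν z, tadpole_add hA (loc_tableRedF_WghAt n x₀ cK 0 μ 0 ν z) (loc_tableRedF_WghAt n x₀ 0 cQ μ 0 ν z),
    bubble_add_left hA (hLK μ 0) (hLQ μ 0) ((hLK ν z).add (hLQ ν z)),
    bubble_add_right hA (hLK μ 0) (hLK ν z) (hLQ ν z), bubble_add_right hA (hLQ μ 0) (hLK ν z) (hLQ ν z)]
  ring

/-- [folklore] **ΔGH AT THE PINS OF RECORD** (`(x₀, cK) = (−1, n²)`, ray `cQ = a`, pinned `cQ = 0`; ρ-g15-4 ∕ ρ-g16-2):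
`2·(PghQ n a (−1) n² 0 − PghQ n a (−1) n² a) μ ν z = −tadpole Ggh (W_Q μ 0 ν z) + (bubble Ggh (V_Q μ 0) (V_K ν z) + bubble Ggh (V_K μ 0) (V_Q ν z) + bubble Ggh (V_Q μ 0) (V_Q ν z))`
— minus the qSq tadpole plus the KQ, QK, QQ bubbles (weights folded in: `V_Q` carries `a`, `W_Q` carries `a·n⁴`, `V_K` carries `n²`). -/
theorem deltaGH_eq_words (ha : 0 < a) (μ ν : Fin 4) (z : Site 4) :
    2 * (PghQ n a (-1) (((n : ℝ) ^ 2)) 0 μ ν z - PghQ n a (-1) (((n : ℝ) ^ 2)) a μ ν z)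
      = -tadpole (Ggh n a) (tableRedF n (WghAt (ctrHalf n) n (-1) 0 a) μ 0 ν z)
        + (bubble (Ggh n a) (vertexRedF n (SghAt (ctrHalf n) n 0 a) μ 0) (vertexRedF n (SghAt (ctrHalf n) n (((n : ℝ) ^ 2)) 0) ν z)
          + bubble (Ggh n a) (vertexRedF n (SghAt (ctrHalf n) n (((n : ℝ) ^ 2)) 0) μ 0) (vertexRedF n (SghAt (ctrHalf n) n 0 a) ν z)
          + bubble (Ggh n a) (vertexRedF n (SghAt (ctrHalf n) n 0 a) μ 0) (vertexRedF n (SghAt (ctrHalf n) n 0 a) ν z)) := by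
  have h := PghQ_sub_PghQ_cQ_zero n ha (-1) (((n : ℝ) ^ 2)) a μ ν z
  linarith

end Identity

end Summit.QuantumFields.BalabanUV.Beta.D1BFx.GhostDeltaWords

end
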